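import Summits.CriticalPhenomena.PercolationContinuityZ3.Theorems.PercNearOneGluingNoHeavyLowerTailCILRelayNeighbours
import HarnessLib

/-!
# `NoHeavyLowerTail` (stmt-CriticalPhenomena-4575) — hull-port line: the first-open-edge decomposition with an
# ARBITRARY witness and one non-relay neighbour

Support file (prover `prim-hp-1`, hull-port / coupling line; `--supports stmt-CriticalPhenomena-4575`).  No definitions,
no named facts, no sorries.

Setting: `μ = prodBernoulli w` on `Fin n`, relays `A`, level `j`, observer `o ∉ A`; the positive-weight neighbours of `o`
are enumerated injectively as `p 0, …, p (d−1)` (all `≠ o`); every `p l` is a relay EXCEPT POSSIBLY THE LAST ONE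
(`p l ∉ A → ∀ m, m ≤ l`).  `H`-reachability `u ~' v` means an open path using no pair at `o` (configuration `ω ∩ {e | o ∉ e}`),
`M_l = |{x ∈ A : p l ~' x}|`, and for a vertex `b ≠ o`, `M_b = |{x ∈ A : b ~' x}|`.  For an index `l` put
`Ξ(l) := {p l ≁' b} ∩ {∀ m > l, p m ~' b → pair o–p m closed}`.

* `HullPort.cil_of_edgeComparison` — if for every `l` with `p l ≠ b`
  `μ(Ξ(l) ∩ {1 ≤ M_l ≤ j}) ≤ μ(Ξ(l) ∩ {M_b ≤ j})`, then `μ{1 ≤ N ≤ j} ≤ μ{|π(b)| ≤ j}`: the witness `b` need not be a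
  neighbour of `o` (nor a relay), and the last neighbour may be a Steiner vertex.  This is the first-open-edge
  decomposition of `Theorems.cil_relayNeighbours_of_portComparison` (prover `prim-gen-induct`) with the witness freed:
  on `F_l = {p l carries the first open pair at o}` either `b ~ o` (then `π(b) = π(o)`) or `Ξ(l)` holds, `M_l ≤ N`, and
  `|π(b)| = M_b`; for a relay `p l` the extra `1 ≤ M_l` is free, for the last (possibly non-relay) neighbour it is `N ≥ 1`
  (no later pair at `o` is open, so `N = M_l`).  No correlation inequality is used.

It is the socket of the hull-port programme (crux evidence HULLPORT-COUPLING.md): the hypotheses for relay neighbours are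
discharged by the two-cluster exchange (`CutObserver.separation_stable` + coin integration), the hypothesis for a last
Steiner neighbour `x` is the cumulative isolation lemma for `x` in `G − o` with the same witness.
-/

noncomputable section

namespace Summit.CriticalPhenomena.PercolationContinuityZ3.Theorems

open MeasureTheory Set Literature.Probability.LatticeModels Literature.Probability.Percolation
open scoped Classical BigOperators

variable {n : ℕ}

namespace HullPort

open CutObserver

/-- **First-open-edge decomposition with a free witness.**  Let `o ∉ A`, let the positive-weight neighbours of `o` be
`p 0, …, p (d−1)` (injective, all `≠ o`), all of them relays except possibly the last index, and let `b ≠ o` be any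
vertex.  With `~'` = reachability without the pairs at `o`, `M_l`/`M_b` the numbers of relays `~'`-joined to `p l`/`b`, and
`Ξ(l) = {p l ≁' b} ∩ {∀ m > l, p m ~' b → o–p m closed}`: if
`μ(Ξ(l) ∩ {1 ≤ M_l ≤ j}) ≤ μ(Ξ(l) ∩ {M_b ≤ j})` for every `l` with `p l ≠ b`, then `μ{1 ≤ N ≤ j} ≤ μ{|π(b)| ≤ j}`.
[folklore] -/
theorem cil_of_edgeComparison (w : Sym2 (Fin n) → unitInterval) (A : Finset (Fin n)) (o : Fin n)
    (j : ℕ) {d : ℕ} (p : Fin d → Fin n) (hp : Function.Injective p) (hpo : ∀ l, p l ≠ o) (hoA : o ∉ A)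
    (hobs : ∀ v, v ≠ o → w s(o, v) ≠ 0 → ∃ l, v = p l) (hlast : ∀ l, p l ∉ A → ∀ m : Fin d, m ≤ l)
    (b : Fin n) (hbo : b ≠ o)
    (hstar : ∀ l, p l ≠ b →
      (prodBernoulli w).real
          ({ω : BondConfig (Fin n) | ¬ (openGraph (ω ∩ {e | o ∉ e})).Reachable (p l) b} ∩
            {ω | ∀ m, l < m → (openGraph (ω ∩ {e | o ∉ e})).Reachable (p m) b → s(o, p m) ∉ ω} ∩
            {ω | 1 ≤ (A.filter fun x => (openGraph (ω ∩ {e | o ∉ e})).Reachable (p l) x).card ∧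
              (A.filter fun x => (openGraph (ω ∩ {e | o ∉ e})).Reachable (p l) x).card ≤ j}) ≤
        (prodBernoulli w).real
          ({ω : BondConfig (Fin n) | ¬ (openGraph (ω ∩ {e | o ∉ e})).Reachable (p l) b} ∩
            {ω | ∀ m, l < m → (openGraph (ω ∩ {e | o ∉ e})).Reachable (p m) b → s(o, p m) ∉ ω} ∩
            {ω | (A.filter fun x => (openGraph (ω ∩ {e | o ∉ e})).Reachable b x).card ≤ j})) :
    (prodBernoulli w).real {ω : BondConfig (Fin n) |
        1 ≤ (A.filter fun x => ω ∈ openConn o x).card ∧ (A.filter fun x => ω ∈ openConn o x).card ≤ j} ≤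
      (prodBernoulli w).real {ω : BondConfig (Fin n) | (A.filter fun x => ω ∈ openConn b x).card ≤ j} := by
  haveI : IsProbabilityMeasure (prodBernoulli w) := inferInstance
  -- notation
  set R : BondConfig (Fin n) → Fin n → Fin n → Prop := fun ω u v =>
    (openGraph (ω ∩ {e | o ∉ e})).Reachable u v with hR
  set M : BondConfig (Fin n) → Fin d → ℕ := fun ω l => (A.filter fun x => R ω (p l) x).card with hM
  set Mb : BondConfig (Fin n) → ℕ := fun ω => (A.filter fun x => R ω b x).card with hMb
  set bad := {ω : BondConfig (Fin n) |
    1 ≤ (A.filter fun x => ω ∈ openConn o x).card ∧ (A.filter fun x => ω ∈ openConn o x).card ≤ j} with hbad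
  set T := {ω : BondConfig (Fin n) | (A.filter fun x => ω ∈ openConn b x).card ≤ j} with hT
  set F : Fin d → Set (BondConfig (Fin n)) := fun l =>
    {ω | s(o, p l) ∈ ω ∧ ∀ m, m < l → s(o, p m) ∉ ω} with hF
  set Ξ : Fin d → Set (BondConfig (Fin n)) := fun l =>
    {ω | ¬ R ω (p l) b} ∩ {ω | ∀ m, l < m → R ω (p m) b → s(o, p m) ∉ ω} with hΞ
  set V := {ω : BondConfig (Fin n) | (openGraph ω).Reachable b o} with hV
  set G := {ω : BondConfig (Fin n) | ∀ e ∈ ω, w e ≠ 0} with hG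
  -- an open pair at `o` (of nonzero weight) ends in some `p m`
  have hport : ∀ ω, ω ∈ G → ∀ v, (openGraph ω).Adj o v → ∃ m, v = p m := by
    intro ω hωG v hadj
    rw [openGraph, SimpleGraph.fromEdgeSet_adj] at hadj
    exact hobs v (Ne.symm hadj.2) (hωG _ hadj.1)
  -- (P4) an open port edge joins the port's H-cluster to o
  have hP4 : ∀ ω (l : Fin d) x, s(o, p l) ∈ ω → R ω (p l) x → (openGraph ω).Reachable o x := by
    intro ω l x hopen hR'
    have hadj : (openGraph ω).Adj o (p l) := by
      rw [openGraph, SimpleGraph.fromEdgeSet_adj]; exact ⟨hopen, (hpo l).symm⟩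
    exact hadj.reachable.trans (reachable_mono inter_subset_left hR')
  -- (P5) on G ∩ F l: b ~ o ⇒ ¬ Ξ l
  have hP5 : ∀ ω (l : Fin d), ω ∈ G → ω ∈ F l → ω ∈ V → ω ∉ Ξ l := by
    intro ω l hωG hFl hVω hΞω
    obtain ⟨hopen, hclosed⟩ := hFl
    obtain ⟨hnot, hlater⟩ := hΞω
    have hreach : (openGraph ω).Reachable o b := SimpleGraph.Reachable.symm hVω
    obtain ⟨wk⟩ := hreach
    set q := wk.bypass with hq
    have hpath : q.IsPath := wk.bypass_isPath
    cases hq' : q with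
    | nil => exact absurd rfl hbo
    | cons hadj q' =>
      rename_i v
      rw [hq'] at hpath
      rw [SimpleGraph.Walk.cons_isPath_iff] at hpath
      obtain ⟨m, rfl⟩ := hport ω hωG v hadj
      rw [openGraph, SimpleGraph.fromEdgeSet_adj] at hadj
      have hRm : R ω (p m) b := reachable_avoiding_of_walk q' hpath.2
      rcases lt_trichotomy m l with hml | rfl | hlm
      · exact hclosed m hml hadj.1
      · exact hnot hRm
      · exact hlater m hlm hRm hadj.1
  -- (P3) off V, the cluster of b is its H-cluster
  have hP3 : ∀ ω, ω ∉ V → (A.filter fun x => ω ∈ openConn b x).card = Mb ω := by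
    intro ω hVω
    rw [hMb]
    congr 1
    refine Finset.filter_congr fun x _ => ⟨fun h => ?_, fun h => reachable_mono inter_subset_left h⟩
    exact reachable_avoiding_of_not_reachable hVω h
  -- (P1) the minority event lies in the union of the F l
  have hP1 : bad ∩ G ⊆ ⋃ l ∈ (Finset.univ : Finset (Fin d)), F l := by
    rintro ω ⟨⟨h1, _⟩, hωG⟩
    obtain ⟨x, hx⟩ := Finset.card_pos.1 (by omega : 0 < (A.filter fun x => ω ∈ openConn o x).card)
    rw [Finset.mem_filter] at hx
    have hxo : x ≠ o := fun h => hoA (h ▸ hx.1)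
    obtain ⟨wk⟩ := (hx.2 : (openGraph ω).Reachable o x)
    cases wk with
    | nil => exact absurd rfl hxo
    | @cons _ v _ hadj _ =>
      obtain ⟨m, rfl⟩ := hport ω hωG v hadj
      rw [openGraph, SimpleGraph.fromEdgeSet_adj] at hadj
      set S := Finset.univ.filter fun m : Fin d => s(o, p m) ∈ ω with hS
      have hSne : S.Nonempty := ⟨m, Finset.mem_filter.2 ⟨Finset.mem_univ _, hadj.1⟩⟩
      refine mem_biUnion (Finset.mem_univ (S.min' hSne)) ⟨(Finset.mem_filter.1 (Finset.min'_mem S hSne)).2, ?_⟩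
      intro m' hm' hopen'
      have : S.min' hSne ≤ m' := Finset.min'_le S m' (Finset.mem_filter.2 ⟨Finset.mem_univ _, hopen'⟩)
      exact absurd hm' (not_lt.2 this)
  -- (P6) on G ∩ F l ∩ bad, if p l is not a relay (hence last), every relay of π(o) is H-joined to p l
  have hP6 : ∀ ω (l : Fin d), ω ∈ G → ω ∈ F l → p l ∉ A → ∀ x ∈ A, (openGraph ω).Reachable o x →
      R ω (p l) x := by
    intro ω l hωG hFl hlA x hxA hox
    have hxo : x ≠ o := fun h => hoA (h ▸ hxA)
    obtain ⟨wk⟩ := hox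
    set q := wk.bypass with hq
    have hpath : q.IsPath := wk.bypass_isPath
    cases hq' : q with
    | nil => exact absurd rfl hxo.symm
    | cons hadj q' =>
      rename_i v
      rw [hq'] at hpath
      rw [SimpleGraph.Walk.cons_isPath_iff] at hpath
      obtain ⟨m, rfl⟩ := hport ω hωG v hadj
      rw [openGraph, SimpleGraph.fromEdgeSet_adj] at hadj
      have hRm : R ω (p m) x := reachable_avoiding_of_walk q' hpath.2
      rcases lt_or_eq_of_le (hlast l hlA m) with hml | hml
      · exact absurd hadj.1 (hFl.2 m hml)
      · rw [← hml]; exact hRm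
  -- supports: port edges up to l vs. H-edges and later port edges
  set Eo : Finset (Sym2 (Fin n)) := Finset.univ.filter fun e : Sym2 (Fin n) => o ∉ e with hEo
  have hcoe : (↑Eo : Set (Sym2 (Fin n))) = {e | o ∉ e} := coe_edgesAvoiding o
  set Early : Fin d → Finset (Sym2 (Fin n)) := fun l =>
    (Finset.univ.filter fun m : Fin d => m ≤ l).image fun m => s(o, p m) with hEarly
  set Late : Fin d → Finset (Sym2 (Fin n)) := fun l =>
    Eo ∪ (Finset.univ.filter fun m : Fin d => l < m).image fun m => s(o, p m) with hLate
  have hdisjEL : ∀ l, Disjoint (Early l) (Late l) := by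
    intro l
    rw [Finset.disjoint_left]
    intro e he he'
    rw [hEarly, Finset.mem_image] at he
    obtain ⟨m, hm, rfl⟩ := he
    rw [Finset.mem_filter] at hm
    rw [hLate, Finset.mem_union] at he'
    rcases he' with h | h
    · rw [hEo, Finset.mem_filter] at h
      exact h.2 (Sym2.mem_mk_left _ _)
    · rw [Finset.mem_image] at h
      obtain ⟨m', hm', heq⟩ := h
      rw [Finset.mem_filter] at hm'
      have : m' = m := hp (Sym2.congr_right.1 heq)
      subst this
      exact absurd (lt_of_lt_of_le hm'.2 hm.2) (lt_irrefl _)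
  have hF_det : ∀ l, DeterminedBy (F l) (↑(Early l) : Set (Sym2 (Fin n))) := by
    intro l
    rw [determinedBy_iff]
    intro ω ω' h
    have key : ∀ m, m ≤ l → (s(o, p m) ∈ ω ↔ s(o, p m) ∈ ω') := by
      intro m hm
      have hmem : s(o, p m) ∈ (↑(Early l) : Set (Sym2 (Fin n))) := by
        rw [Finset.mem_coe, hEarly, Finset.mem_image]
        exact ⟨m, Finset.mem_filter.2 ⟨Finset.mem_univ _, hm⟩, rfl⟩
      have := Set.ext_iff.1 h (s(o, p m))
      simp only [mem_inter_iff, hmem, and_true] at this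
      exact this
    simp only [hF, mem_setOf_eq]
    rw [key l le_rfl]
    constructor
    · rintro ⟨h1, h2⟩; exact ⟨h1, fun m hm => (key m hm.le).not.1 (h2 m hm)⟩
    · rintro ⟨h1, h2⟩; exact ⟨h1, fun m hm => (key m hm.le).not.2 (h2 m hm)⟩
  -- a generic `H`-event intersected with Ξ l is determined by the late support
  have hH_det : ∀ (l : Fin d) (P : BondConfig (Fin n) → Prop),
      DeterminedBy (Ξ l ∩ {ω | P (ω ∩ {e | o ∉ e})}) (↑(Late l) : Set (Sym2 (Fin n))) := by
    intro l P
    rw [determinedBy_iff]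
    intro ω ω' h
    have hH : ω ∩ {e | o ∉ e} = ω' ∩ {e | o ∉ e} := by
      rw [← hcoe]
      ext f
      have := Set.ext_iff.1 h f
      simp only [hLate, Finset.coe_union, mem_inter_iff, mem_union, Finset.mem_coe] at this ⊢
      constructor
      · rintro ⟨hf, hfE⟩; exact ⟨(this.1 ⟨hf, Or.inl hfE⟩).1, hfE⟩
      · rintro ⟨hf, hfE⟩; exact ⟨(this.2 ⟨hf, Or.inl hfE⟩).1, hfE⟩
    have hlate : ∀ m, l < m → (s(o, p m) ∈ ω ↔ s(o, p m) ∈ ω') := by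
      intro m hm
      have hmem : s(o, p m) ∈ (↑(Late l) : Set (Sym2 (Fin n))) := by
        rw [Finset.mem_coe, hLate, Finset.mem_union, Finset.mem_image]
        exact Or.inr ⟨m, Finset.mem_filter.2 ⟨Finset.mem_univ _, hm⟩, rfl⟩
      have := Set.ext_iff.1 h (s(o, p m))
      simp only [mem_inter_iff, hmem, and_true] at this
      exact this
    simp only [hΞ, hR, mem_inter_iff, mem_setOf_eq]
    rw [hH]
    constructor
    · rintro ⟨⟨h1, h2⟩, h3⟩
      exact ⟨⟨h1, fun m hm hr => (hlate m hm).not.1 (h2 m hm hr)⟩, h3⟩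
    · rintro ⟨⟨h1, h2⟩, h3⟩
      exact ⟨⟨h1, fun m hm hr => (hlate m hm).not.2 (h2 m hm hr)⟩, h3⟩
  -- the two H-events of the comparison, written through `ω ∩ {e | o ∉ e}`
  set PL : Fin d → BondConfig (Fin n) → Prop := fun l ξ =>
    1 ≤ (A.filter fun x => (openGraph ξ).Reachable (p l) x).card ∧
      (A.filter fun x => (openGraph ξ).Reachable (p l) x).card ≤ j with hPL
  set PB : BondConfig (Fin n) → Prop := fun ξ =>
    (A.filter fun x => (openGraph ξ).Reachable b x).card ≤ j with hPB
  have hEL : ∀ l, Ξ l ∩ {ω | PL l (ω ∩ {e | o ∉ e})} = Ξ l ∩ {ω | 1 ≤ M ω l ∧ M ω l ≤ j} := by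
    intro l; ext ω; simp only [hPL, hM, hR, mem_inter_iff, mem_setOf_eq]
  have hEB : ∀ l, Ξ l ∩ {ω | PB (ω ∩ {e | o ∉ e})} = Ξ l ∩ {ω | Mb ω ≤ j} := by
    intro l; ext ω; simp only [hPB, hMb, hR, mem_inter_iff, mem_setOf_eq]
  have hfactorL : ∀ l, (prodBernoulli w).real (F l ∩ (Ξ l ∩ {ω | 1 ≤ M ω l ∧ M ω l ≤ j})) =
      (prodBernoulli w).real (F l) * (prodBernoulli w).real (Ξ l ∩ {ω | 1 ≤ M ω l ∧ M ω l ≤ j}) := by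
    intro l
    rw [← hEL l]
    exact prodBernoulli_real_inter_of_determinedBy_disjoint w (hdisjEL l) (hF_det l) (hH_det l (PL l))
      MeasurableSet.of_discrete MeasurableSet.of_discrete
  have hfactorB : ∀ l, (prodBernoulli w).real (F l ∩ (Ξ l ∩ {ω | Mb ω ≤ j})) =
      (prodBernoulli w).real (F l) * (prodBernoulli w).real (Ξ l ∩ {ω | Mb ω ≤ j}) := by
    intro l
    rw [← hEB l]
    exact prodBernoulli_real_inter_of_determinedBy_disjoint w (hdisjEL l) (hF_det l) (hH_det l PB)
      MeasurableSet.of_discrete MeasurableSet.of_discrete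
  -- the hypothesis in the internal notation
  have hstar' : ∀ l, p l ≠ b →
      (prodBernoulli w).real (Ξ l ∩ {ω | 1 ≤ M ω l ∧ M ω l ≤ j}) ≤
        (prodBernoulli w).real (Ξ l ∩ {ω | Mb ω ≤ j}) := by
    intro l hlb
    have h := hstar l hlb
    simp only [hΞ, hM, hMb, hR]
    exact h
  -- per-port comparison
  have hper : ∀ l, (prodBernoulli w).real (F l ∩ bad ∩ G) ≤ (prodBernoulli w).real (F l ∩ T) := by
    intro l
    by_cases hlb : p l = b
    · -- the pair o–b is open on F l: b ~ o and the two events coincide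
      refine measureReal_mono (fun ω hω => ?_) (measure_ne_top _ _)
      obtain ⟨⟨hFl, hb⟩, _⟩ := hω
      have hVω : ω ∈ V := by
        have hadj : (openGraph ω).Adj b o := by
          rw [openGraph, SimpleGraph.fromEdgeSet_adj, Sym2.eq_swap, ← hlb]; exact ⟨hFl.1, hpo l⟩
        exact hadj.reachable
      refine ⟨hFl, ?_⟩
      show (A.filter fun x => ω ∈ openConn b x).card ≤ j
      have heq : (A.filter fun x => ω ∈ openConn b x) = (A.filter fun x => ω ∈ openConn o x) :=
        Finset.filter_congr fun x _ =>
          ⟨fun h => (SimpleGraph.Reachable.symm hVω).trans h, fun h => hVω.trans h⟩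
      rw [heq]; exact hb.2
    have hsplit : F l ∩ bad ∩ G ⊆ (F l ∩ T ∩ V) ∪ (F l ∩ (Ξ l ∩ {ω | 1 ≤ M ω l ∧ M ω l ≤ j})) := by
      rintro ω ⟨⟨hFl, hb⟩, hωG⟩
      by_cases hVω : ω ∈ V
      · refine Or.inl ⟨⟨hFl, ?_⟩, hVω⟩
        show (A.filter fun x => ω ∈ openConn b x).card ≤ j
        have heq : (A.filter fun x => ω ∈ openConn b x) = (A.filter fun x => ω ∈ openConn o x) :=
          Finset.filter_congr fun x _ =>
            ⟨fun h => (SimpleGraph.Reachable.symm hVω).trans h, fun h => hVω.trans h⟩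
        rw [heq]; exact hb.2
      · have hΞω : ω ∈ Ξ l := by
          refine ⟨fun hr => hVω ?_, fun m hm hr hopen => hVω ?_⟩
          · exact ((hP4 ω l b hFl.1 hr)).symm
          · exact ((hP4 ω m b hopen hr)).symm
        have hMle : M ω l ≤ j := by
          refine le_trans (Finset.card_le_card fun x hx => ?_) hb.2
          rw [Finset.mem_filter] at hx ⊢
          exact ⟨hx.1, hP4 ω l x hFl.1 hx.2⟩
        have hMge : 1 ≤ M ω l := by
          by_cases hlA : p l ∈ A
          · refine Finset.card_pos.2 ⟨p l, Finset.mem_filter.2 ⟨hlA, ?_⟩⟩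
            exact SimpleGraph.Reachable.refl _
          · refine le_trans hb.1 (Finset.card_le_card fun x hx => ?_)
            rw [Finset.mem_filter] at hx ⊢
            exact ⟨hx.1, hP6 ω l hωG hFl hlA x hx.1 hx.2⟩
        exact Or.inr ⟨hFl, hΞω, hMge, hMle⟩
    have hback : F l ∩ (Ξ l ∩ {ω | Mb ω ≤ j}) ∩ G ⊆ (F l ∩ T) \ V := by
      rintro ω ⟨⟨hFl, hΞω, hMbj⟩, hωG⟩
      have hVω : ω ∉ V := fun hVω => hP5 ω l hωG hFl hVω hΞω
      refine ⟨⟨hFl, ?_⟩, hVω⟩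
      show (A.filter fun x => ω ∈ openConn b x).card ≤ j
      rw [hP3 ω hVω]; exact hMbj
    calc (prodBernoulli w).real (F l ∩ bad ∩ G)
        ≤ (prodBernoulli w).real ((F l ∩ T ∩ V) ∪ (F l ∩ (Ξ l ∩ {ω | 1 ≤ M ω l ∧ M ω l ≤ j}))) :=
          measureReal_mono hsplit (measure_ne_top _ _)
      _ ≤ (prodBernoulli w).real (F l ∩ T ∩ V) +
            (prodBernoulli w).real (F l ∩ (Ξ l ∩ {ω | 1 ≤ M ω l ∧ M ω l ≤ j})) :=
          measureReal_union_le _ _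
      _ = (prodBernoulli w).real (F l ∩ T ∩ V) +
            (prodBernoulli w).real (F l) * (prodBernoulli w).real (Ξ l ∩ {ω | 1 ≤ M ω l ∧ M ω l ≤ j}) := by
          rw [hfactorL]
      _ ≤ (prodBernoulli w).real (F l ∩ T ∩ V) +
            (prodBernoulli w).real (F l) * (prodBernoulli w).real (Ξ l ∩ {ω | Mb ω ≤ j}) := by
          have := mul_le_mul_of_nonneg_left (hstar' l hlb)
            (measureReal_nonneg (μ := prodBernoulli w) (s := F l))
          linarith
      _ = (prodBernoulli w).real (F l ∩ T ∩ V) + (prodBernoulli w).real (F l ∩ (Ξ l ∩ {ω | Mb ω ≤ j})) := by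
          rw [hfactorB]
      _ = (prodBernoulli w).real (F l ∩ T ∩ V) +
            (prodBernoulli w).real (F l ∩ (Ξ l ∩ {ω | Mb ω ≤ j}) ∩ G) := by rw [measureReal_inter_support]
      _ ≤ (prodBernoulli w).real (F l ∩ T ∩ V) + (prodBernoulli w).real ((F l ∩ T) \ V) := by
          have := measureReal_mono (μ := prodBernoulli w) hback (measure_ne_top _ _)
          linarith
      _ = (prodBernoulli w).real (F l ∩ T) :=
          measureReal_inter_add_sdiff (MeasurableSet.of_discrete (s := V)) (measure_ne_top _ _)
  -- the F l are pairwise disjoint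
  have hFdisj : (↑(Finset.univ : Finset (Fin d)) : Set (Fin d)).PairwiseDisjoint fun l => F l ∩ T := by
    intro l _ l' _ hll'
    rw [Function.onFun, Set.disjoint_left]
    rintro ω ⟨⟨hopen, hclosed⟩, _⟩ ⟨⟨hopen', hclosed'⟩, _⟩
    rcases lt_or_gt_of_ne hll' with h | h
    · exact hclosed' l h hopen
    · exact hclosed l' h hopen'
  -- assemble
  calc (prodBernoulli w).real bad
      = (prodBernoulli w).real (bad ∩ G) := (measureReal_inter_support w bad).symm
    _ ≤ (prodBernoulli w).real (⋃ l ∈ (Finset.univ : Finset (Fin d)), F l ∩ bad ∩ G) := by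
        refine measureReal_mono (fun ω hω => ?_) (measure_ne_top _ _)
        have := hP1 hω
        rw [mem_iUnion₂] at this ⊢
        obtain ⟨l, hl, hFl⟩ := this
        exact ⟨l, hl, ⟨hFl, hω.1⟩, hω.2⟩
    _ ≤ ∑ l ∈ (Finset.univ : Finset (Fin d)), (prodBernoulli w).real (F l ∩ bad ∩ G) :=
        measureReal_biUnion_finset_le _ _
    _ ≤ ∑ l ∈ (Finset.univ : Finset (Fin d)), (prodBernoulli w).real (F l ∩ T) :=
        Finset.sum_le_sum fun l _ => hper l
    _ = (prodBernoulli w).real (⋃ l ∈ (Finset.univ : Finset (Fin d)), F l ∩ T) :=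
        (measureReal_biUnion_finset hFdisj fun l _ => MeasurableSet.of_discrete).symm
    _ ≤ (prodBernoulli w).real T :=
        measureReal_mono (iUnion₂_subset fun l _ => inter_subset_right) (measure_ne_top _ _)

end HullPort

end Summit.CriticalPhenomena.PercolationContinuityZ3.Theorems

end
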